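import Summits.HodgeConjecture.HodgeConjecture.Theses.KuznetsovCYFactory

/-!
# Route KuznetsovCYFactory — `Assembly` (assembly item stmt-HodgeConjecture-14552)

The assembly item of route `KuznetsovCYFactory`,

  HodgeModels → AlgebraicClassesIsoInvariant → VariationalHodgeSmooth → AnchorExistence → _root_.HodgeConjecture,

is the route's deciding theorem `KuznetsovCYFactory.closes` curried (its hypotheses are the route's crux items `VariationalHodgeSmooth`, `AnchorExistence`, `HodgeModels` in another order; the item's extra hypothesis `AlgebraicClassesIsoInvariant` is not needed (the deciding theorem proves iso-invariance of `algebraicClasses` inline) and is discarded).  Pure logic over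
the route file; no other import, no named-fact hypothesis, no sorry.
-/

-- `Summit.HodgeConjecture.HodgeConjecture.Theorems` is the mandated namespace (single-problem
-- summit: Problem = Summit), which `linter.dupNamespace` flags on every declaration; the lakefile
-- turns the linter off tree-wide (weak option), restated here so stand-alone elaboration is
-- warning-free too.
set_option linter.dupNamespace false

namespace Summit.HodgeConjecture.HodgeConjecture.Theorems

/-- **Item stmt-HodgeConjecture-14552 (`Assembly`), route `KuznetsovCYFactory`**: the route's items imply the
Hodge conjecture — the deciding theorem `KuznetsovCYFactory.closes`, curried.  The type is the route
decl `Summit.HodgeConjecture.HodgeConjecture.Theses.KuznetsovCYFactory.Assembly`. -/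
theorem kuznetsovCYFactory_assembly_proof :
    Summit.HodgeConjecture.HodgeConjecture.Theses.KuznetsovCYFactory.Assembly :=
  fun hM _ hV hAn ↦
    Summit.HodgeConjecture.HodgeConjecture.Theses.KuznetsovCYFactory.closes hV hAn hM

end Summit.HodgeConjecture.HodgeConjecture.Theorems
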